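import Summits.BirchSwinnertonDyer.BirchSwinnertonDyer.Theorems.KatoDescentPotSupersingularCartanMuRoadDoors
import Summits.BirchSwinnertonDyer.BirchSwinnertonDyer.Theorems.KatoDescentPotSupersingularWildFineSelmerSupersingularCMAnchor
import Summits.BirchSwinnertonDyer.BirchSwinnertonDyer.Theorems.AdditiveBranchIMCGordTwoRankOneSmallImageDickson
import Literature.NumberTheory.EllipticCurves.ModThreeImageCubeDiscriminantProofs
import HarnessLib

/-!
# Route `KatoDescentPotSupersingular` (rung K9, sub-rung B5 = O6 wild `p = 3`, cell `bsd-potss`): the FUKUDA layer door on the WHOLE division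
# field `L = ℚ(W[3])` with Fukuda's index HYPOTHESIS `3 ∤ #Gal(L/ℚ)` PUT IN THE KERNEL — U₀ `MissingUpperBoundAt W 3` on an irreducible rank-`0`
# O6 row whose mod-`3` representation is NOT onto, from ONE integer equality `e_{n+1}(L) = e_n(L)` (resp. `r_{n+1}(L) = r_n(L)`) up the
# cyclotomic `ℤ₃`-tower of `L` (seat `bsd-potss-k9-c4` g22; route-free; `--supports stmt-BirchSwinnertonDyer-19197 --as helper`; closes nothing)

HONEST FRAMING. THEOREMS ONLY (no definition, no named fact, no `sorry`); nothing is booked; items 19189 / 19197 / 19942 stay OPEN at class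
level; (A), Conjecture A and BSD are proved for NO curve here.  Companion of this seat's `…WildUpperDivisionFieldClassNumberDoor` (p651201,
Iwasawa 1956 on `L`): here the classical `μ = 0` for `L_cyc/L` comes from FUKUDA 1994 Thm. 1 (named facts `hF1` = part (1), orders;
`hF2` = part (2), `p`-ranks) through conjA-anchor g8's binder-free doors `CartanMuRoadDoors.conjA_of_classNumberPExp_succ_eq` /
`conjA_of_classGroupPRank_succ_eq` (p573777), whose displayed hypothesis `hd : p ∤ #Gal(ℚ(W[p])/ℚ)` (Fukuda's index `n₀ = 0`: every prime
of `L` above `p` is totally ramified in `L_cyc/L` from layer `0`) is DISCHARGED IN THE KERNEL by Serre's Prop. 15 — the tree theorem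
`SmallImageDickson.not_dvd_card_aut_divisionField` (k1 lane, p547579 ff.): `W[p]` irreducible and `ρ̄_{W,p}` not onto ⟹ `p ∤ #Gal(ℚ(W[p])/ℚ)`.
At `p = 3` «not onto» is itself kernel-checkable per row from a CUBE discriminant (`ModThreeImage.not_hasSurjectiveModNGaloisRep_three_of_Δ_eq_cube`,
Serre §5.3), so the records over this door display, besides the named facts and Cremona's `r_an = 0`, exactly ONE numerical hypothesis:
the equality of two class-number exponents (or `3`-ranks) of `L = ℚ(W[3])` and of its first cyclotomic layer `L₁ = L·ℚ(ζ₉)⁺`.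

USE (this seat's records `…WildUpperMuRoadThreeFukudaRecordsNN`, g22): the 27 U₀-ns `3Ns` rows of 19189 → 19197 that conjA-anchor g8's census
(kit j289900) marks `FUKUDA-L(0,1)`: `L` of degree 8, `3 ∤ h(L)` CERTIFIED, `3 ∤ h(L₁)` (degree 24, GRH) ⟹ `e₁(L) = e₀(L) = 0`.

References: [Fukuda1994] Thm. 1 (1), (2) (p. 264); [Serre1972] §2.4 Prop. 15, §5.3; [Washington1997] §13.1, Prop. 13.2; [CoatesSujatha2005] Thm. 3.4 (§3);
[Kato2004Asterisque] Thm. 12.5 (3), Thm. 14.5 (3).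
-/

set_option linter.dupNamespace false
set_option autoImplicit false

noncomputable section

open scoped NumberField
open Field IntermediateField WeierstrassCurve IsDedekindDomain Literature.NumberTheory.EllipticCurves
  Literature.NumberTheory.GaloisRepresentations Literature.NumberTheory.SerreUniformity
  Literature.NumberTheory.IwasawaTheory Literature.NumberTheory.EllipticCurves.Rank1Residual.Typed
  Summit.BirchSwinnertonDyer.Rank1Residual.Additive
  Summit.BirchSwinnertonDyer.BirchSwinnertonDyer.Theorems.AdditiveBranchIMCGordTwoRankOne

namespace Summit.BirchSwinnertonDyer.BirchSwinnertonDyer.Theorems.DivisionFieldFukudaDoor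

/-! ## §1 Fukuda's index hypothesis `p ∤ #Gal(ℚ(W[p])/ℚ)` from the kernel: irreducible + not onto (Serre Prop. 15); at `p = 3` from a cube `Δ` -/

section Index

variable (W : WeierstrassCurve ℚ) [W.IsElliptic]

/-- **`3 ∤ #Gal(ℚ(W[3])/ℚ)` from `W[3]` irreducible and a CUBE discriminant** (`Δ = d³` ⟹ `ρ̄_{W,3}` not onto, Serre §5.3; then Serre's
Prop. 15, tree theorem `SmallImageDickson.not_dvd_card_aut_divisionField`).  Kernel-checkable per row (`Δ = d³` by `norm_num`).
[cite: Serre1972, §2.4 Prop. 15, §5.3] -/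
theorem not_dvd_card_aut_divisionField_three_of_Δ_eq_cube [Fact (3 : ℕ).Prime] (hirr : W.HasIrreducibleModPGaloisRep 3) {d : ℚ}
    (hΔ : W.Δ = d ^ 3) : ¬ 3 ∣ Nat.card (W.divisionField 3 ≃ₐ[ℚ] W.divisionField 3) :=
  SmallImageDickson.not_dvd_card_aut_divisionField W 3 hirr (ModThreeImage.not_hasSurjectiveModNGaloisRep_three_of_Δ_eq_cube W hΔ)

end Index

/-! ## §2 Statement (A) at `(W, p)`, `p` odd, from Fukuda's layer equality on `ℚ(W[p])` — index hypothesis from irreducible + not onto -/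

section ConjA

variable (W : WeierstrassCurve ℚ) [W.IsElliptic]

/-- **(A) at `(W, p)` from Fukuda's class-number-ORDER equality `e_{n+1}(L) = e_n(L)`, `L = ℚ(W[p])`** (`p` odd, `W[p]` irreducible,
`ρ̄_{W,p}` not onto — whence Fukuda's index is `0` by Serre's Prop. 15, kernel), modulo the named facts Fukuda 1994 Thm. 1 (1) (`hF1`) and
Coates–Sujatha Thm. 3.4 (`hCS`).  = conjA-anchor g8's `CartanMuRoadDoors.conjA_of_classNumberPExp_succ_eq` with `hd` discharged.
CONDITIONAL on the two facts; (A) is not asserted. [cite: Fukuda1994, Thm. 1 (1), p. 264] [cite: Serre1972, §2.4 Prop. 15]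
[cite: CoatesSujatha2005, Thm. 3.4 (§3)] -/
theorem conjA_of_notSurj_of_classNumberPExp_succ_eq
    (hF1 : fukuda1994_thm1_classNumberPExp_const_of_succ_eq)
    (hCS : CoatesSujatha2005.thm34_fineSelmerDual_moduleFinite_of_classicalMuVanishes_divisionField)
    (p : ℕ) [Fact p.Prime] (hp : p ≠ 2) (hirr : W.HasIrreducibleModPGaloisRep p) (hns : ¬ W.HasSurjectiveModNGaloisRep p) (n : ℕ)
    (hord : haveI : NeZero p := ⟨(Fact.out : p.Prime).ne_zero⟩
      ∀ κL : ZpExtension (W.divisionField p) p, κL.IsCyclotomic → classNumberPExp κL (n + 1) = classNumberPExp κL n)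
    (κ : ZpExtension ℚ p) (hκ : κ.IsCyclotomic) :
    ∃ (γ : absoluteGaloisGroup ℚ) (D : W.FineSelmerDualData κ γ),
      Module.Finite ℤ_[p] (RestrictScalars ℤ_[p] (IwasawaAlgebra p) D.X) :=
  haveI : NeZero p := ⟨(Fact.out : p.Prime).ne_zero⟩
  CartanMuRoadDoors.conjA_of_classNumberPExp_succ_eq hF1 hCS W p hp (SmallImageDickson.not_dvd_card_aut_divisionField W p hirr hns)
    n hord κ hκ

/-- **(A) at `(W, p)` from Fukuda's `p`-RANK equality `r_{n+1}(L) = r_n(L)`, `L = ℚ(W[p])`** (`p` odd, `W[p]` irreducible, `ρ̄_{W,p}` not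
onto), modulo Fukuda 1994 Thm. 1 (2) (`hF2`) and Coates–Sujatha Thm. 3.4 (`hCS`).  = `CartanMuRoadDoors.conjA_of_classGroupPRank_succ_eq` with
`hd` discharged.  CONDITIONAL; (A) is not asserted. [cite: Fukuda1994, Thm. 1 (2), p. 264] [cite: Serre1972, §2.4 Prop. 15] [cite: CoatesSujatha2005, Thm. 3.4 (§3)] -/
theorem conjA_of_notSurj_of_classGroupPRank_succ_eq
    (hF2 : fukuda1994_thm1_classGroupPRank_const_of_succ_eq)
    (hCS : CoatesSujatha2005.thm34_fineSelmerDual_moduleFinite_of_classicalMuVanishes_divisionField)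
    (p : ℕ) [Fact p.Prime] (hp : p ≠ 2) (hirr : W.HasIrreducibleModPGaloisRep p) (hns : ¬ W.HasSurjectiveModNGaloisRep p) (n : ℕ)
    (hrk : haveI : NeZero p := ⟨(Fact.out : p.Prime).ne_zero⟩
      ∀ κL : ZpExtension (W.divisionField p) p, κL.IsCyclotomic → classGroupPRank κL (n + 1) = classGroupPRank κL n)
    (κ : ZpExtension ℚ p) (hκ : κ.IsCyclotomic) :
    ∃ (γ : absoluteGaloisGroup ℚ) (D : W.FineSelmerDualData κ γ),
      Module.Finite ℤ_[p] (RestrictScalars ℤ_[p] (IwasawaAlgebra p) D.X) :=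
  haveI : NeZero p := ⟨(Fact.out : p.Prime).ne_zero⟩
  CartanMuRoadDoors.conjA_of_classGroupPRank_succ_eq hF2 hCS W p hp (SmallImageDickson.not_dvd_card_aut_divisionField W p hirr hns)
    n hrk κ hκ

end ConjA

/-! ## §3 U₀ `MissingUpperBoundAt W 3` on an irreducible, non-surjective rank-`0` O6 row from one Fukuda layer equality on `ℚ(W[3])` -/

section Upper

variable (W : WeierstrassCurve ℚ) [W.IsElliptic] [W.IsGloballyMinimal]

set_option synthInstance.maxHeartbeats 400000 in
/-- **U₀ at an irreducible non-surjective rank-`0` O6 row from ONE Fukuda equality `e_{n+1}(ℚ(W[3])) = e_n(ℚ(W[3]))`**: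
`MissingUpperBoundAt W 3` (`ord₃ #Ш(W) ≤ ord₃ #Ш_an(W)`) for `r_an = 0`, `ClassO6 W 3`, `W[3]` irreducible, `ρ̄_{W,3}` not onto, from the
named facts A161-fine `hKatoA`, GZK `hGZK`, modularity `hmod`, Coates–Sujatha Thm. 3.4 `hCS`, Fukuda Thm. 1 (1) `hF1`, and the displayed
`hord` (k9-c4 g5's fine-Selmer port `missingUpperBoundAt_wild_of_conjA` ∘ §2).  CONDITIONAL; nothing booked; BSD for no curve.
[cite: Kato2004Asterisque, Thm. 14.5 (3) (p. 236), Thm. 12.5 (3) (p. 222)] [cite: Fukuda1994, Thm. 1 (1), p. 264] [cite: Serre1972, §2.4 Prop. 15]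
[cite: CoatesSujatha2005, Thm. 3.4 (§3)] -/
theorem missingUpperBoundAt_three_of_notSurj_of_classNumberPExp_succ_eq
    (hKatoA : Kato2004.rankZero_padicValNat_sha_add_padicValNat_tamagawa_le_of_additive_potGood_of_irreducible_of_fineSelmerDual_fg)
    (hGZK : rank_eq_analyticRank_of_analyticRank_le_one) (hmod : hasEntireLFunction_rat)
    (hCS : CoatesSujatha2005.thm34_fineSelmerDual_moduleFinite_of_classicalMuVanishes_divisionField)
    (hF1 : fukuda1994_thm1_classNumberPExp_const_of_succ_eq) [Fact (3 : ℕ).Prime]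
    (hr : W.analyticRank = 0) (hO : ClassO6 W 3) (hirr : W.HasIrreducibleModPGaloisRep 3) (hns : ¬ W.HasSurjectiveModNGaloisRep 3) (n : ℕ)
    (hord : ∀ κL : ZpExtension (W.divisionField 3) 3, κL.IsCyclotomic → classNumberPExp κL (n + 1) = classNumberPExp κL n) :
    MissingUpperBoundAt W 3 :=
  WildFineSelmerSupersingularCMAnchor.missingUpperBoundAt_wild_of_conjA hKatoA hGZK hmod W hr hO hirr
    (conjA_of_notSurj_of_classNumberPExp_succ_eq W hF1 hCS 3 (by decide) hirr hns n hord)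

set_option synthInstance.maxHeartbeats 400000 in
/-- **U₀ at an irreducible non-surjective rank-`0` O6 row from ONE Fukuda equality of `3`-RANKS `r_{n+1}(ℚ(W[3])) = r_n(ℚ(W[3]))`**
(named facts `hKatoA hGZK hmod hCS` and Fukuda Thm. 1 (2) `hF2`; displayed `hrk`).  CONDITIONAL; nothing booked; BSD for no curve.
[cite: Kato2004Asterisque, Thm. 14.5 (3) (p. 236)] [cite: Fukuda1994, Thm. 1 (2), p. 264] [cite: Serre1972, §2.4 Prop. 15] [cite: CoatesSujatha2005, Thm. 3.4 (§3)] -/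
theorem missingUpperBoundAt_three_of_notSurj_of_classGroupPRank_succ_eq
    (hKatoA : Kato2004.rankZero_padicValNat_sha_add_padicValNat_tamagawa_le_of_additive_potGood_of_irreducible_of_fineSelmerDual_fg)
    (hGZK : rank_eq_analyticRank_of_analyticRank_le_one) (hmod : hasEntireLFunction_rat)
    (hCS : CoatesSujatha2005.thm34_fineSelmerDual_moduleFinite_of_classicalMuVanishes_divisionField)
    (hF2 : fukuda1994_thm1_classGroupPRank_const_of_succ_eq) [Fact (3 : ℕ).Prime]
    (hr : W.analyticRank = 0) (hO : ClassO6 W 3) (hirr : W.HasIrreducibleModPGaloisRep 3) (hns : ¬ W.HasSurjectiveModNGaloisRep 3) (n : ℕ)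
    (hrk : ∀ κL : ZpExtension (W.divisionField 3) 3, κL.IsCyclotomic → classGroupPRank κL (n + 1) = classGroupPRank κL n) :
    MissingUpperBoundAt W 3 :=
  WildFineSelmerSupersingularCMAnchor.missingUpperBoundAt_wild_of_conjA hKatoA hGZK hmod W hr hO hirr
    (conjA_of_notSurj_of_classGroupPRank_succ_eq W hF2 hCS 3 (by decide) hirr hns n hrk)

end Upper

end Summit.BirchSwinnertonDyer.BirchSwinnertonDyer.Theorems.DivisionFieldFukudaDoor

end
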